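import Summits.ResolutionOfSingularities.ResolutionOfSingularities.Theorems.TameTwoStoreyLU
import HarnessLib

/-!
# TameTwoStoreyLU1B — decomp-res lens-1 g29 node «TameTwoStorey» ((W-α) WHOLE; critic letter row 219c pre-ruling + the row on ROW REQUEST INBOX :1741), PART A continued

Content VERBATIM from `HOME/decomp-res-lens-1/g29/land/TameTwoStoreyLU.lean` (sha256 91011d3d, 433 l) lines 337–433: the Nakayama extraction lemmas
`ne_zero_of_span_eq_maximalIdeal` (every member of a regular system of `d` parameters of a `d`-dimensional regular local ring is non-zero) and
`exists_fin_of_span_eq_maximalIdeal`; HOME = run/shared/lean/pub/decomp-res.  [WRITER NOTE (decomp-res writer g14): second half of the re-cut of S1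
by the gate's 400-line lint; namespace, `noncomputable section`, `open`s, `universe u`, `section GenericA` and its `variable` line replayed from S1;
provenance, thesis and sources in full in the header of `TameTwoStoreyLU`.]  `--kind proof --supports stmt-ResolutionOfSingularities-0641`; nothing here
proves `ResolutionOfSingularities` (rung 0).
-/

noncomputable section

open IsLocalRing Polynomial IntermediateField Literature.AlgebraicGeometry.Resolution
open Summit.ResolutionOfSingularities.ResolutionOfSingularities.Theorems.TameQuotientLU
open Summit.ResolutionOfSingularities.ResolutionOfSingularities.Theorems.TameAbelianQuotientLU
open Summit.ResolutionOfSingularities.ResolutionOfSingularities.Theorems.InertiaIsotypicStability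
open Summit.ResolutionOfSingularities.ResolutionOfSingularities.Theorems.TameInertialLU
open Summit.ResolutionOfSingularities.ResolutionOfSingularities.Theorems.TameAbelianMonomialChart

namespace Summit.ResolutionOfSingularities.ResolutionOfSingularities.Theorems.TameTwoStoreyLU

universe u

/-! ## Part A — generic tools over a valued field `(E, O_E)`

`zpow` membership, primes below a non-unit natural number, restriction of `O_E`-stable automorphisms to `O_E` and to the
residue field, the INERTIA SEPARATOR (an `O_E`-element fixed by the inertia group `T` of a finite group `G` of `O_E`-stable
automorphisms and moved to residual distance `1` by every `g ∉ T`), the non-vanishing of the members of a regular system of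
parameters, and the Nakayama extraction of a regular system of parameters from a spanning set. -/

section GenericA

variable {E : Type u} [Field E] (OE : ValuationSubring E)

/-- In a regular local ring of dimension `d`, every member of a regular system of `d` parameters is non-zero.
[folklore] -/
theorem ne_zero_of_span_eq_maximalIdeal {B : Type*} [CommRing B] [IsRegularLocalRing B] {d : ℕ}
    (hBdim : ringKrullDim B = d) (x : Fin d → B)
    (hspan : Ideal.span (Set.range x) = maximalIdeal B) (j₀ : Fin d) : x j₀ ≠ 0 := by
  classical
  intro hxj
  have hspan' : Ideal.span (((Finset.univ.erase j₀).image x : Finset B) : Set B) =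
      maximalIdeal B := by
    rw [← hspan]
    apply le_antisymm
    · refine Ideal.span_mono ?_
      intro b hb
      obtain ⟨j, -, rfl⟩ := Finset.mem_image.mp (Finset.mem_coe.mp hb)
      exact ⟨j, rfl⟩
    · refine Ideal.span_le.mpr ?_
      rintro _ ⟨j, rfl⟩
      by_cases hj : j = j₀
      · subst hj; rw [hxj]; exact Ideal.zero_mem _
      · exact Ideal.subset_span (Finset.mem_coe.mpr (Finset.mem_image.mpr
          ⟨j, Finset.mem_erase.mpr ⟨hj, Finset.mem_univ j⟩, rfl⟩))
  have h1 : ((maximalIdeal B).spanFinrank : WithBot ℕ∞) = ringKrullDim B :=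
    IsRegularLocalRing.spanFinrank_maximalIdeal
  have h2 : (maximalIdeal B).spanFinrank ≤ d - 1 := by
    rw [← hspan']
    calc (Ideal.span (((Finset.univ.erase j₀).image x : Finset B) : Set B)).spanFinrank
        ≤ (((Finset.univ.erase j₀).image x : Finset B) : Set B).ncard :=
          Submodule.spanFinrank_span_le_ncard_of_finite (Finset.finite_toSet _)
      _ = ((Finset.univ.erase j₀).image x).card := Set.ncard_coe_finset _
      _ ≤ (Finset.univ.erase j₀).card := Finset.card_image_le
      _ = d - 1 := by rw [Finset.card_erase_of_mem (Finset.mem_univ _), Finset.card_univ,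
          Fintype.card_fin]
  rw [hBdim] at h1
  have h3 : (maximalIdeal B).spanFinrank = d := by exact_mod_cast h1
  have : 0 < d := Fin.pos j₀
  omega

/-- **Nakayama extraction.**  In a regular local ring `B` of dimension `d`, a subset `U ⊆ 𝔪_B` with `span U = 𝔪_B`
contains a regular system of parameters `u₁, …, u_d`. [folklore; Mat86 Thm 2.3 / 14] -/
theorem exists_fin_of_span_eq_maximalIdeal {B : Type*} [CommRing B] [IsRegularLocalRing B] {d : ℕ}
    (hBdim : ringKrullDim B = d) (U : Set B) (hU : U ⊆ maximalIdeal B)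
    (hspanU : Ideal.span U = maximalIdeal B) :
    ∃ u : Fin d → B, (∀ j, u j ∈ U) ∧ Ideal.span (Set.range u) = maximalIdeal B := by
  classical
  set κ := ResidueField B with hκ
  set V := CotangentSpace B with hV
  let U' : Set (maximalIdeal B) := {m | (m : B) ∈ U}
  have hU'img : (maximalIdeal B).subtype '' U' = U := by
    ext b
    constructor
    · rintro ⟨m, hm, rfl⟩; exact hm
    · intro hb; exact ⟨⟨b, hU hb⟩, hb, rfl⟩
  have hspanB : Submodule.span B U' = ⊤ := by
    apply Submodule.map_injective_of_injective (maximalIdeal B).injective_subtype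
    rw [Submodule.map_span, hU'img, Submodule.map_top, Submodule.range_subtype]
    exact hspanU
  have hspanκ : Submodule.span κ ((maximalIdeal B).toCotangent '' U') = ⊤ :=
    IsLocalRing.CotangentSpace.span_image_eq_top_iff.mpr hspanB
  let w : U' → V := fun m => (maximalIdeal B).toCotangent (m : maximalIdeal B)
  have hwrange : Set.range w = (maximalIdeal B).toCotangent '' U' := by
    ext v
    constructor
    · rintro ⟨m, rfl⟩; exact ⟨m, m.2, rfl⟩
    · rintro ⟨m, hm, rfl⟩; exact ⟨⟨m, hm⟩, rfl⟩
  obtain ⟨ι, a, -, hspan_eq, hli⟩ := exists_linearIndependent' (K := κ) w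
  have hspanι : Submodule.span κ (Set.range (w ∘ a)) = ⊤ := by
    rw [hspan_eq, hwrange, hspanκ]
  haveI : Finite ι := hli.finite
  letI : Fintype ι := Fintype.ofFinite ι
  let bas : Module.Basis ι κ V := Module.Basis.mk hli (le_of_eq hspanι.symm)
  have hfinrank : Module.finrank κ V = d := by
    have h1 := (IsRegularLocalRing.iff_finrank_cotangentSpace B).mp inferInstance
    rw [hBdim] at h1
    exact_mod_cast h1
  have hcard : Fintype.card ι = d := by
    rw [← hfinrank, Module.finrank_eq_card_basis bas]
  let eqv : ι ≃ Fin d := Fintype.equivFinOfCardEq hcard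
  let uu : Fin d → maximalIdeal B := fun j => ((a (eqv.symm j)) : maximalIdeal B)
  have huU : ∀ j, (uu j : B) ∈ U := fun j => (a (eqv.symm j)).2
  have huspan : Submodule.span B (Set.range uu) = ⊤ := by
    apply IsLocalRing.CotangentSpace.span_image_eq_top_iff.mp
    rw [← Set.range_comp]
    have h1 : (maximalIdeal B).toCotangent ∘ uu = (w ∘ a) ∘ eqv.symm := by
      ext j; rfl
    rw [h1, Set.range_comp, eqv.symm.range_eq_univ, Set.image_univ, hspanι]
  refine ⟨fun j => (uu j : B), huU, ?_⟩
  have h1 : Set.range (fun j => (uu j : B)) = (maximalIdeal B).subtype '' Set.range uu := by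
    rw [← Set.range_comp]; rfl
  rw [h1]
  change Submodule.span B _ = _
  rw [← Submodule.map_span, huspan, Submodule.map_top, Submodule.range_subtype]

end GenericA

end Summit.ResolutionOfSingularities.ResolutionOfSingularities.Theorems.TameTwoStoreyLU

end
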